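import Literature.AlgebraicGeometry.RelativeSpec.GeometricQuotientTameFlat
import Literature.AlgebraicGeometry.RelativeSpec.GeometricQuotientSmoothCurveField
import Literature.AlgebraicGeometry.RelativeSpec.ActionOverPullback
import Literature.RingTheory.Idempotents.InvariantsOfNormalCurveChart
import Literature.AlgebraicGeometry.Morphisms.SmoothOfFlatFibre
import Literature.AlgebraicGeometry.Motives.AbelianVarietyProofs
import Mathlib.AlgebraicGeometry.Morphisms.Smooth
import Mathlib.AlgebraicGeometry.Fiber
import HarnessLib

/-!
# The quotient of a smooth relative CURVE by a finite group of invertible order is a smooth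
# relative curve ([KatzMazur1985] A7.1; [SGA1] Exp. V §1; fibrewise criterion EGA IV₄ 17.5.1)

Let `r : X → Y` be smooth of relative dimension `1` over an affine locally Noetherian base `Y`
(e.g. `Y = Spec O`, `O` a discrete valuation ring), let the finite group `G` act on `X` over `Y`
(`RelativeSpec.ActionOver r G`) with a `G`-stable affine cover, and suppose `|G| ∈ Γ(Y, 𝒪_Y)ˣ`
(a TAME action).  Then the glued quotient `X/G → Y` (★ `ActionOver.glued`, `gluedDesc`) is again
smooth of relative dimension `1` (`ActionOver.smoothOfRelativeDimension_one_gluedDesc_of_fieldCase`, modulo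
the field case),
and proper if `r` is (★ `ActionOver.isProper_gluedDesc`), i.e. a smooth proper model in the sense of
`Motives.IntegralModel.IsSmoothProper 1`.

Proof (fibrewise).  (a) `X/G → Y` is flat and locally of finite presentation
(★ `ActionOver.flat_gluedDesc_of_isUnit_card_base`, ★ `ActionOver.locallyOfFinitePresentation_gluedDesc`:
Reynolds retraction).  (b) For every `y ∈ Y` the fibre `(X/G)_y` is the geometric quotient of
`X ×_{X/G} (X/G)_y = X_y` by the base-changed action (★ `ActionOver.isGeometricQuotient_baseChange_of_isUnit_card`,
[MumfordFogartyKirwan1994] Ch. 1 §2 Amplification 1.3 — this is where `|G| ∈ 𝒪ˣ` enters), and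
`X_y → Spec κ(y)` is smooth of relative dimension `1` (base change).  (c) FIELD CASE: the quotient of
a smooth curve over the perfect field `κ(y)` by a finite group is a smooth curve (normal of
dimension `1` ⇒ regular ⇒ smooth over a perfect field) — taken here as the hypothesis `hfield`
(scheme form, verbatim the statement of the field case; discharged in the companion file
`GeometricQuotientSmoothCurveField`).  (d) A flat morphism locally of finite presentation with
smooth fibres is smooth (★ `Morphisms.mem_smoothLocus_of_flat_stalkMap_of_smooth_fiber`, Stacks 01V8).
(e) The relative dimension is read off the fibres: near any point `x`, `X/G → Y` is smooth of some
relative dimension `d` (★ `Motives.exists_opens_smoothOfRelativeDimension_of_smooth`); restricting to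
the fibre through `x`, which is smooth of relative dimension `1`, forces `d = 1`
(★ `Motives.AbelianVarietyProofs.eq_of_smoothOfRelativeDimension`; Hartshorne III 10.1 (b)).

* `ActionOver.smooth_of_smooth_fiberToSpecResidueField` — (a)+(d): `X/G → Y` is smooth as soon as
  all its fibres are smooth over the residue fields;
* `ActionOver.smoothOfRelativeDimension_of_fibres` — (e): and smooth of relative dimension `n` as
  soon as all its fibres are;
* `ActionOver.isGeometricQuotient_fibre`, `ActionOver.smoothOfRelativeDimension_fibreSource` — (b);
* `ActionOver.smoothOfRelativeDimension_one_gluedDesc_of_fieldCase` — the theorem modulo the field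
  case `hfield` (the unconditional `…_of_isUnit_card` is appended once the field case lands);
* `ActionOver.smoothOfRelativeDimension_one_and_isProper_gluedDesc_of_fieldCase` — with properness.

Everything is proved; no named facts, no definitions; the field case enters as an explicit
hypothesis.

Mathlib searched (pin): `Scheme.Hom.fiber`, `Scheme.Hom.fiberι`, `Scheme.Hom.fiberToSpecResidueField`,
`Scheme.Hom.asFiber`, `Scheme.Hom.fiberι_asFiber`, `Scheme.Hom.smoothLocus_eq_top_iff`, `Flat.stalkMap`,
`smoothOfRelativeDimension_isStableUnderBaseChange`, `MorphismProperty.IsStableUnderBaseChange.of_isPullback`,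
`IsPullback.paste_vert`, `isPullback_morphismRestrict`, `IsZariskiLocalAtSource.of_iSup_eq_top`
(all used); Mathlib has no quotients of schemes by finite groups.

## References

* N. M. Katz, B. Mazur, *Arithmetic Moduli of Elliptic Curves* (1985), Appendix A7.1 (quotients by
  finite groups of order invertible on the base). [KatzMazur1985]
* A. Grothendieck, *SGA 1*, Exp. V, §1 (Prop. 1.8, Prop. 1.9, Cor. 1.5). [SGA1]
* A. Grothendieck, J. Dieudonné, *EGA IV₄* (1967), Thm. 17.5.1, Prop. 17.7.4. [EGAIV4]
* D. Mumford, J. Fogarty, F. Kirwan, *Geometric Invariant Theory* (1994), Ch. 1 §2 Ampl. 1.3.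
  [MumfordFogartyKirwan1994]
* R. Hartshorne, *Algebraic Geometry* (1977), Ch. III Prop. 10.1 (b). [Hartshorne1977]
-/

noncomputable section

universe u

open CategoryTheory Limits AlgebraicGeometry Opposite TopologicalSpace

namespace Literature.AlgebraicGeometry.RelativeSpec

namespace ActionOver

/-! ### (a)+(d) Smoothness and relative dimension are read off the fibres -/

section Fibres

variable {Q Y : Scheme.{u}} (q : Q ⟶ Y)

/-- **A flat morphism locally of finite presentation all of whose fibres are smooth is smooth**
(Stacks 01V8, assembled pointwise from ★ `Morphisms.mem_smoothLocus_of_flat_stalkMap_of_smooth_fiber`).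
[cite: EGAIV4, Thm. 17.5.1] [cite: StacksProject, Tag 01V8] -/
theorem smooth_of_smooth_fiberToSpecResidueField [Flat q] [LocallyOfFinitePresentation q]
    (hfib : ∀ y : Y, Smooth (q.fiberToSpecResidueField y)) : Smooth q := by
  rw [← Scheme.Hom.smoothLocus_eq_top_iff]
  exact top_le_iff.mp fun z _ =>
    Morphisms.mem_smoothLocus_of_flat_stalkMap_of_smooth_fiber q (Flat.stalkMap q z) (hfib (q z))

/-- **The relative dimension of a smooth morphism is read off its fibres**: if `q` is smooth and every
fibre `q⁻¹(y) → Spec κ(y)` is smooth of relative dimension `n`, then `q` is smooth of relative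
dimension `n` (near `x`, `q` is smooth of some relative dimension `d`; the non-empty trace of that
chart on the fibre through `x` is smooth of relative dimensions `d` and `n` over `κ(q x)`).
[cite: Hartshorne1977, Ch. III Prop. 10.1 (b)] [cite: EGAIV4, Prop. 17.7.4] -/
theorem smoothOfRelativeDimension_of_fibres [Smooth q] (n : ℕ)
    (hfib : ∀ y : Y, SmoothOfRelativeDimension n (q.fiberToSpecResidueField y)) :
    SmoothOfRelativeDimension n q := by
  choose V d hxV hV using
    Literature.AlgebraicGeometry.Motives.exists_opens_smoothOfRelativeDimension_of_smooth q
  have hd : ∀ x, d x = n := fun x => by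
    let y := q x
    let pr := q.fiberι y
    have H : IsPullback pr (q.fiberToSpecResidueField y) q (Y.fromSpecResidueField y) :=
      IsPullback.of_hasPullback q (Y.fromSpecResidueField y)
    have hx : x ∈ Set.range pr.base := ⟨q.asFiber x, q.fiberι_asFiber x⟩
    obtain ⟨x', hx'⟩ := hx
    have hx'V : x' ∈ pr ⁻¹ᵁ V x := by
      change pr x' ∈ V x
      rw [hx']; exact hxV x
    haveI : Nonempty ((pr ⁻¹ᵁ V x : (q.fiber y).Opens) : Scheme.{u}) := ⟨⟨x', hx'V⟩⟩
    have sq : IsPullback (pr ∣_ V x) ((pr ⁻¹ᵁ V x).ι ≫ q.fiberToSpecResidueField y) ((V x).ι ≫ q)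
        (Y.fromSpecResidueField y) :=
      (isPullback_morphismRestrict pr (V x)).paste_vert H
    haveI := smoothOfRelativeDimension_isStableUnderBaseChange (n := d x)
    have h₁ : SmoothOfRelativeDimension (d x) ((pr ⁻¹ᵁ V x).ι ≫ q.fiberToSpecResidueField y) :=
      MorphismProperty.of_isPullback sq (hV x)
    have h₂ : SmoothOfRelativeDimension n ((pr ⁻¹ᵁ V x).ι ≫ q.fiberToSpecResidueField y) :=
      IsZariskiLocalAtSource.comp (hfib y) _
    exact Literature.AlgebraicGeometry.Motives.AbelianVarietyProofs.eq_of_smoothOfRelativeDimension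
      _ h₁ h₂
  have hcov : iSup V = ⊤ := top_le_iff.mp fun x _ => Opens.mem_iSup.mpr ⟨x, hxV x⟩
  exact IsZariskiLocalAtSource.of_iSup_eq_top (P := @SmoothOfRelativeDimension n) V hcov
    fun x => hd x ▸ hV x

end Fibres

/-! ### (b) The fibre of the quotient is the quotient of the fibre -/

section FibreQuotient

variable {X Y : Scheme.{u}} {r : X ⟶ Y} {G : Type*} [Group G] (ρ : ActionOver r G)

variable {Q : Scheme.{u}} (p : X ⟶ Q) (hp : ∀ g : G, (ρ.aut g).hom ≫ p = p) (q : Q ⟶ Y) (y : Y)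

/-- **The fibre of a tame geometric quotient is the geometric quotient of the fibre**: for an affine
geometric quotient `p : X → Q` over `Y` with `|G| ∈ Γ(Q, 𝒪_Q)ˣ` and any `y ∈ Y`, the base change
`X ×_Q Q_y → Q_y` is a geometric quotient by the base-changed action
`(⟨ρ.aut, hp⟩ : ActionOver p G).baseChange (q.fiberι y)` (★ `ActionOver.baseChange`: `ρ(g) × id` on
`X ×_Q Q_y`). [cite: MumfordFogartyKirwan1994, Ch. 1 §2 Amplification 1.3] [cite: SGA1, Exp. V §1, Prop. 1.9] -/
theorem isGeometricQuotient_fibre [Finite G] (hq : ρ.IsGeometricQuotient p) [IsAffineHom p]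
    (hG : IsUnit ((Nat.card G : ℕ) : Γ(Q, ⊤))) :
    ((⟨ρ.aut, hp⟩ : ActionOver p G).baseChange (q.fiberι y)).IsGeometricQuotient
      (pullback.snd p (q.fiberι y)) :=
  ρ.isGeometricQuotient_baseChange_of_isUnit_card hq hG
    (IsPullback.of_hasPullback p (q.fiberι y)) ((⟨ρ.aut, hp⟩ : ActionOver p G).baseChange (q.fiberι y))
    fun g => by simp

/-- The base change `X ×_Q Q_y → Q_y` of an affine `p` is affine. [folklore] -/
private theorem isAffineHom_fibre_snd [IsAffineHom p] : IsAffineHom (pullback.snd p (q.fiberι y)) :=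
  MorphismProperty.IsStableUnderBaseChange.of_isPullback (P := @IsAffineHom)
    (IsPullback.of_hasPullback p (q.fiberι y)) inferInstance

/-- `X ×_Q Q_y` is the fibre `X_y` of `r = p ≫ q`: the square over `Spec κ(y) → Y` is cartesian.
[folklore] -/
private theorem isPullback_fibreSource (hpq : p ≫ q = r) :
    IsPullback (pullback.fst p (q.fiberι y))
      (pullback.snd p (q.fiberι y) ≫ q.fiberToSpecResidueField y) r (Y.fromSpecResidueField y) := by
  have H : IsPullback (q.fiberι y) (q.fiberToSpecResidueField y) q (Y.fromSpecResidueField y) :=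
    IsPullback.of_hasPullback q (Y.fromSpecResidueField y)
  have := (IsPullback.of_hasPullback p (q.fiberι y)).paste_vert H
  rwa [hpq] at this

/-- **`X ×_Q Q_y → Spec κ(y)` is smooth of relative dimension `n` if `r : X → Y` is**
(base change along `Spec κ(y) → Y`). [cite: Hartshorne1977, Ch. III Prop. 10.1 (b)] -/
theorem smoothOfRelativeDimension_fibreSource (hpq : p ≫ q = r) (n : ℕ)
    [SmoothOfRelativeDimension n r] :
    SmoothOfRelativeDimension n (pullback.snd p (q.fiberι y) ≫ q.fiberToSpecResidueField y) :=
  haveI := smoothOfRelativeDimension_isStableUnderBaseChange (n := n)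
  MorphismProperty.of_isPullback (isPullback_fibreSource p q y hpq) inferInstance

end FibreQuotient

/-! ### (c)+(e) The theorem -/

section Main

variable {X Y : Scheme.{u}} {r : X ⟶ Y} {G : Type u} [Group G] (ρ : ActionOver r G)
  [Finite G] [Y.IsSeparated] [IsSeparated r] (hcov : ∀ x : X, ∃ O : ρ.StableAffineOpens, x ∈ O.1)

set_option backward.isDefEq.respectTransparency false

include hcov in
/-- **The quotient of a smooth relative curve by a finite group of invertible order is a smooth
relative curve** (modulo the field case `hfield`, stated verbatim in scheme form: over a perfect
field, an affine geometric quotient of a scheme smooth of relative dimension `1` by `G`, with target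
locally of finite type, is smooth of relative dimension `1`).  For `r : X → Y` smooth of relative
dimension `1` over an affine locally Noetherian `Y` with perfect residue fields, `G` finite acting over
`Y` with a stable affine cover and `|G| ∈ Γ(Y, 𝒪_Y)ˣ`: `X/G → Y` is smooth of relative dimension `1`.
[cite: KatzMazur1985, A7.1] [cite: SGA1, Exp. V §1, Prop. 1.8 and Prop. 1.9] [cite: EGAIV4, Thm. 17.5.1] -/
theorem smoothOfRelativeDimension_one_gluedDesc_of_fieldCase [IsAffine Y] [IsLocallyNoetherian Y]
    [SmoothOfRelativeDimension 1 r] (hG : IsUnit ((Nat.card G : ℕ) : Γ(Y, ⊤)))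
    (hperf : ∀ y : Y, PerfectField (Y.residueField y))
    (hfield : ∀ (y : Y), PerfectField (Y.residueField y) →
      ∀ ⦃Z Z' : Scheme.{u}⦄ (p : Z ⟶ Z') (ρZ : ActionOver p G)
        (t : Z' ⟶ Spec (Y.residueField y)), ρZ.IsGeometricQuotient p → IsAffineHom p →
        SmoothOfRelativeDimension 1 (p ≫ t) → LocallyOfFiniteType t → SmoothOfRelativeDimension 1 t) :
    SmoothOfRelativeDimension 1 (ρ.gluedDesc r ρ.aut_comp) := by
  haveI : Smooth r := SmoothOfRelativeDimension.smooth 1 r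
  let π := ρ.gluedMk hcov
  let q := ρ.gluedDesc r ρ.aut_comp
  have hπq : π ≫ q = r := ρ.gluedMk_gluedDesc hcov r ρ.aut_comp
  have hq : ρ.IsGeometricQuotient π := ρ.isGeometricQuotient_gluedMk hcov
  have hGQ : IsUnit ((Nat.card G : ℕ) : Γ(ρ.glued, ⊤)) := by
    simpa using hG.map (q.appTop).hom
  -- (a) flat and locally of finite presentation
  haveI : Flat q := ρ.flat_gluedDesc_of_isUnit_card_base hcov hG
  haveI : LocallyOfFinitePresentation q := ρ.locallyOfFinitePresentation_gluedDesc
  -- (b)+(c) every fibre is smooth of relative dimension `1`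
  have hfib : ∀ y : Y, SmoothOfRelativeDimension 1 (q.fiberToSpecResidueField y) := fun y => by
    haveI := smoothOfRelativeDimension_fibreSource π q y hπq 1
    haveI := isAffineHom_fibre_snd π q y
    haveI : LocallyOfFiniteType (q.fiberToSpecResidueField y) :=
      MorphismProperty.pullback_snd _ _ inferInstance
    exact hfield y (hperf y) (pullback.snd π (q.fiberι y))
      ((⟨ρ.aut, ρ.aut_hom_gluedMk hcov⟩ : ActionOver π G).baseChange (q.fiberι y))
      (q.fiberToSpecResidueField y) (ρ.isGeometricQuotient_fibre π (ρ.aut_hom_gluedMk hcov) q y hq hGQ)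
      inferInstance inferInstance inferInstance
  -- (d)+(e)
  haveI : Smooth q := smooth_of_smooth_fiberToSpecResidueField q
    fun y => SmoothOfRelativeDimension.smooth 1 _
  exact smoothOfRelativeDimension_of_fibres q 1 hfib

include hcov in
/-- **Smooth proper model**: under the same hypotheses and `r` proper, `X/G → Y` is smooth of relative
dimension `1` AND proper (★ `isProper_gluedDesc`, SGA 1 V 1.5) — the shape
`Motives.IntegralModel.IsSmoothProper 1` of the tree's good-reduction vocabulary.
[cite: KatzMazur1985, A7.1] [cite: SGA1, Exp. V, Cor. 1.5 and Prop. 1.9] -/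
theorem smoothOfRelativeDimension_one_and_isProper_gluedDesc_of_fieldCase [IsAffine Y]
    [IsLocallyNoetherian Y] [SmoothOfRelativeDimension 1 r] (hr : IsProper r)
    (hG : IsUnit ((Nat.card G : ℕ) : Γ(Y, ⊤))) (hperf : ∀ y : Y, PerfectField (Y.residueField y))
    (hfield : ∀ (y : Y), PerfectField (Y.residueField y) →
      ∀ ⦃Z Z' : Scheme.{u}⦄ (p : Z ⟶ Z') (ρZ : ActionOver p G)
        (t : Z' ⟶ Spec (Y.residueField y)), ρZ.IsGeometricQuotient p → IsAffineHom p →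
        SmoothOfRelativeDimension 1 (p ≫ t) → LocallyOfFiniteType t → SmoothOfRelativeDimension 1 t) :
    SmoothOfRelativeDimension 1 (ρ.gluedDesc r ρ.aut_comp) ∧ IsProper (ρ.gluedDesc r ρ.aut_comp) :=
  haveI : Smooth r := SmoothOfRelativeDimension.smooth 1 r
  haveI := hr
  ⟨ρ.smoothOfRelativeDimension_one_gluedDesc_of_fieldCase hcov hG hperf hfield,
    ρ.isProper_gluedDesc hcov r ρ.aut_comp (𝟙 Y) (Category.comp_id _)⟩

end Main

/-! ### ED. 2 — the unconditional theorem

The field case is ★ `ActionOver.fieldCase_of_ring` (`RelativeSpec/GeometricQuotientSmoothCurveField`)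
over the ring-level statement ★ `RingTheory.Idempotents.smooth_fixedPointsSubalgebra_of_normal_of_ringKrullDim_le_one`
(`RingTheory/Idempotents/InvariantsOfNormalCurveChart`: the invariants of a finite group acting on a
normal one-dimensional algebra of finite type over a perfect field form a smooth algebra), so the
hypothesis `hfield` of `smoothOfRelativeDimension_one_gluedDesc_of_fieldCase` is discharged. -/

section Unconditional

variable {X Y : Scheme.{u}} {r : X ⟶ Y} {G : Type u} [Group G] (ρ : ActionOver r G)
  [Finite G] [Y.IsSeparated] [IsSeparated r] (hcov : ∀ x : X, ∃ O : ρ.StableAffineOpens, x ∈ O.1)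

set_option backward.isDefEq.respectTransparency false

include hcov in
/-- **The quotient of a smooth relative curve by a finite group of invertible order is a smooth
relative curve.**  For `r : X → Y` smooth of relative dimension `1` over an affine locally Noetherian
`Y` with perfect residue fields (e.g. `Y = Spec O`, `O` the local ring of a number field at a finite
place), `G` finite acting over `Y` with a `G`-stable affine cover and `|G| ∈ Γ(Y, 𝒪_Y)ˣ`:
`X/G → Y` is smooth of relative dimension `1`.
[cite: KatzMazur1985, A7.1] [cite: SGA1, Exp. V §1, Prop. 1.8 and Prop. 1.9] [cite: EGAIV4, Thm. 17.5.1] -/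
theorem smoothOfRelativeDimension_one_gluedDesc_of_isUnit_card [IsAffine Y] [IsLocallyNoetherian Y]
    [SmoothOfRelativeDimension 1 r] (hG : IsUnit ((Nat.card G : ℕ) : Γ(Y, ⊤)))
    (hperf : ∀ y : Y, PerfectField (Y.residueField y)) :
    SmoothOfRelativeDimension 1 (ρ.gluedDesc r ρ.aut_comp) :=
  ρ.smoothOfRelativeDimension_one_gluedDesc_of_fieldCase hcov hG hperf fun y _ =>
    ActionOver.fieldCase_of_ring
      (fun l A _ _ _ _ _ _ _ _ hdom hic hdim =>
        Literature.RingTheory.Idempotents.smooth_fixedPointsSubalgebra_of_normal_of_ringKrullDim_le_one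
          l A G hdom hic hdim)
      (Y.residueField y)

include hcov in
/-- **Smooth proper model of relative dimension `1`**: under the same hypotheses and `r` proper,
`X/G → Y` is smooth of relative dimension `1` and proper — `Motives.IntegralModel.IsSmoothProper 1` for
the quotient model. [cite: KatzMazur1985, A7.1] [cite: SGA1, Exp. V, Cor. 1.5 and Prop. 1.9] -/
theorem smoothOfRelativeDimension_one_and_isProper_gluedDesc_of_isUnit_card [IsAffine Y]
    [IsLocallyNoetherian Y] [SmoothOfRelativeDimension 1 r] (hr : IsProper r)
    (hG : IsUnit ((Nat.card G : ℕ) : Γ(Y, ⊤))) (hperf : ∀ y : Y, PerfectField (Y.residueField y)) :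
    SmoothOfRelativeDimension 1 (ρ.gluedDesc r ρ.aut_comp) ∧ IsProper (ρ.gluedDesc r ρ.aut_comp) :=
  haveI : Smooth r := SmoothOfRelativeDimension.smooth 1 r
  haveI := hr
  ⟨ρ.smoothOfRelativeDimension_one_gluedDesc_of_isUnit_card hcov hG hperf,
    ρ.isProper_gluedDesc hcov r ρ.aut_comp (𝟙 Y) (Category.comp_id _)⟩

end Unconditional

end ActionOver

end Literature.AlgebraicGeometry.RelativeSpec

end
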